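import Literature.NumberTheory.GaloisRepresentations.PadicEisensteinOrder
import Literature.NumberTheory.GaloisRepresentations.PicardCurveGaloisRep
import Literature.NumberTheory.EllipticCurves.TateModuleRank
import Literature.NumberTheory.EllipticCurves.TateModuleFree
import HarnessLib

/-!
# `T₃ J(C_f) ≅ ℤ₃[ω]³`: the Tate module of `y³ = f(x)` over `K ∋ ζ₃` as a `ℤ₃[ω]`-module

Topic `Literature/NumberTheory/GaloisRepresentations`.  For a superelliptic curve `C_f : y³ = f(x)`
(`f ∈ K[X]` separable, `3 ∤ deg f`) over a field `K` containing a primitive cube root of unity `ζ`, the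
deck transformation `δ : y ↦ ζ y` acts on `Pic(C_{f,K̄})` and on the Tate module
`T = T₃ Pic(C_{f,K̄}) = TateModule (GeomPic K 3 f) 3`, commuting with `Γ_K`
(`SuperellipticPicGaloisModule`), and satisfies `δ² + δ + 1 = 0` on `T` (norm relation on `Pic⁰`,
`SuperellipticLambdaTorsionCoprime`).  Hence `T` is a module over the Eisenstein order
`ℤ₃[ω] = PadicEisenstein` (`PadicEisensteinOrder`, `ω ↦ δ`) on which `Γ_K` acts `ℤ₃[ω]`-linearly:

* `deckGen`, `deckEnd`, `deckEnd_sq_add_deckEnd_add_one`, `tateModulePadicEisenstein` (the module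
  structure, a reducible non-instance used with `letI`), `omega_smul_tateModule`, `lam_smul_tateModule`,
  `isScalarTower_tateModule`, `absoluteGaloisGroup_smul_padicEisenstein_smul`;
* `mem_geomLambdaTorsion_iff` — `Pic[3] ∩ ker(1 - δ) = J[λ]`;
* `card_quotient_lamSubmodule` — **`#(T/λT) = #J[λ]`** when `#Pic[3ⁿ] = 3^{dn}` for all `n`
  (`T → Pic[3] → Pic[3]/(1-δ)Pic[3]` is onto with kernel `λT`, and `(1-δ)|Pic[3]` has kernel `J[λ]`);
* `nonempty_basis_tateModule` — `T` is free of rank `r` over `ℤ₃[ω]` when `#Pic[3ⁿ] = 3^{2rn}` and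
  `#J[λ] = 3^r` (`PadicEisenstein.nonempty_basis_of_card_quotient`); `PadicEisenstein.exists_basis_of_span`
  — the variant with prescribed reduction modulo `λ` (any lift of a spanning family of `T/λT` is a basis);
* the Picard curve (`f ∈ ℤ[X]` a separable quartic, `K ⊇ ℚ(ω)`): `picard_card_geomLambdaTorsion`
  (`#J[λ] = 27`, from `J[λ] ≅ (𝔽₃^{roots})⁰`) and **`picard_nonempty_basis_tateModule`**:
  `T₃ J(C_f) ≅ ℤ₃[ω]³` GIVEN the torsion count `#J_f[3ⁿ] = 3^{6n}` of a genus-`3` curve (the classical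
  input `J[N] ≅ (ℤ/N)^{2g}`, not available in the tree, enters as the hypothesis `hcard`).

This is the coefficient structure of the `λ`-adic (`λ = 1 - ω`) representation of a Picard curve
(Upton 2009, §2; Serre, *Abelian ℓ-adic representations* I §1.1, §2.3 for `E_λ`-coefficients): in a
`ℤ₃[ω]`-basis of `T`, `Γ_K → GL₃(ℤ₃[ω]) ⊂ GL₃(ℚ̄₃)` (`PicardCurveGaloisRep`).  Everything is proved; no
named facts.

## References
* C. Upton, *Galois representations attached to Picard curves*, J. Algebra 322 (2009), §2. [Upton2009]
* J.-P. Serre, *Abelian ℓ-adic representations and elliptic curves* (1968), Ch. I §1.1, §2.3.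
  [SerreAbelianLadic1968]
* Yu. G. Zarhin, arXiv:1706.00110, §8 (`ℤ[ζ_q] ↪ End J`, `J_λ`). [Zarhin2018SuperellipticJacobians]
* E. F. Schaefer, Math. Ann. 310 (1998), §3. [Schaefer1998]
-/

noncomputable section

open Polynomial

/-! ### Freeness over `ℤ₃[ω]` with prescribed reduction -/

namespace Literature.NumberTheory.GaloisRepresentations.PadicEisenstein

section Free

variable {T : Type*} [AddCommGroup T] [Module PadicEisenstein T] [Module ℤ_[3] T]
  [IsScalarTower ℤ_[3] PadicEisenstein T] [Module.Free ℤ_[3] T] [Module.Finite ℤ_[3] T]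

local notation "ω" => omega
local notation "λ'" => lam

/-- **Freeness over `ℤ₃[ω]`, with prescribed basis.**  Let `T` be a `ℤ₃[ω]`-module, free of rank
`2 · #ι` over `ℤ₃`, and let `t : ι → T` be a family whose images span `T/λT`, in the sense that every
`x ∈ T` is `Σ cᵢ tᵢ + λ s`.  Then `t` IS a `ℤ₃[ω]`-basis of `T` (same argument as
`nonempty_basis_of_card_quotient`: `T = Σ ℤ₃[ω] tᵢ + λT = Σ ℤ₃[ω] tᵢ + 3T`, Nakayama over `ℤ₃`, and a
surjection `ℤ₃[ω]^ι → T` between free `ℤ₃`-modules of equal rank is injective).  This form lets one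
choose the reduction of the basis modulo `λ` (e.g. adapted to `T/λT ≅ J[λ]`).
[cite: SerreAbelianLadic1968, Ch. I §1.1] -/
theorem exists_basis_of_span {ι : Type*} [Fintype ι] (hrank : Module.finrank ℤ_[3] T = 2 * Fintype.card ι)
    (t : ι → T) (hspan : ∀ x : T, ∃ (c : ι → PadicEisenstein) (s : T), x = ∑ i, c i • t i + λ' • s) :
    ∃ b : Module.Basis ι PadicEisenstein T, ∀ i, b i = t i := by
  classical
  set φ : (ι → PadicEisenstein) →ₗ[PadicEisenstein] T := Fintype.linearCombination PadicEisenstein t with hφ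
  set N : Submodule PadicEisenstein T := LinearMap.range φ with hN
  have hφ_single : ∀ i, φ (Pi.single i 1) = t i := fun i => by
    rw [hφ, Fintype.linearCombination_apply_single, one_smul]
  -- `N + λT = T`
  have hsup : ∀ x : T, ∃ n ∈ N, ∃ s : T, x = n + λ' • s := by
    intro x
    obtain ⟨c, s, rfl⟩ := hspan x
    exact ⟨∑ i, c i • t i, N.sum_mem fun i _ => N.smul_mem _ ⟨Pi.single i 1, hφ_single i⟩, s, rfl⟩
  -- hence `N + 3T = T`
  have hsup3 : ∀ x : T, ∃ n ∈ N, ∃ s : T, x = n + (3 : ℤ_[3]) • s := by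
    intro x
    obtain ⟨n₁, hn₁, s₁, rfl⟩ := hsup x
    obtain ⟨n₂, hn₂, s₂, hs₁⟩ := hsup s₁
    obtain ⟨n₃, hn₃, s₃, hs₂⟩ := hsup s₂
    refine ⟨n₁ + λ' • n₂ + λ' • (λ' • n₃), ?_, -(ω * λ') • s₃, ?_⟩
    · exact N.add_mem (N.add_mem hn₁ (N.smul_mem _ hn₂)) (N.smul_mem _ (N.smul_mem _ hn₃))
    · rw [hs₁, hs₂, ← lam_pow_three_smul]
      simp only [smul_add]
      abel
  have hN3 : (⊤ : Submodule ℤ_[3] T) ≤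
      N.restrictScalars ℤ_[3] ⊔ (IsLocalRing.maximalIdeal ℤ_[3]) • (⊤ : Submodule ℤ_[3] T) := by
    intro x _
    obtain ⟨n, hn, s, rfl⟩ := hsup3 x
    refine Submodule.add_mem_sup hn ?_
    rw [PadicInt.maximalIdeal_eq_span_p]
    exact Submodule.smul_mem_smul (Ideal.mem_span_singleton_self _) Submodule.mem_top
  -- Nakayama over `ℤ₃`
  have hNtop : (⊤ : Submodule ℤ_[3] T) ≤ N.restrictScalars ℤ_[3] :=
    Submodule.le_of_le_smul_of_le_jacobson_bot Module.Finite.fg_top (IsLocalRing.maximalIdeal_le_jacobson _)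
      hN3
  have hsurj : Function.Surjective φ := fun x =>
    LinearMap.mem_range.1 ((Submodule.restrictScalars_mem ℤ_[3] N x).1 (hNtop Submodule.mem_top))
  -- injectivity by ranks (Orzech)
  have hrank' : Module.finrank ℤ_[3] (ι → PadicEisenstein) = Module.finrank ℤ_[3] T := by
    rw [Module.finrank_pi_fintype, finrank_eq_two, Finset.sum_const, Finset.card_univ, smul_eq_mul, hrank, mul_comm]
  set e : T ≃ₗ[ℤ_[3]] (ι → PadicEisenstein) := LinearEquiv.ofFinrankEq _ _ hrank'.symm with he
  have hinj : Function.Injective φ := by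
    have hg : Function.Surjective ((φ.restrictScalars ℤ_[3]).comp e.toLinearMap) := by
      simp only [LinearMap.coe_comp, LinearMap.coe_restrictScalars, LinearEquiv.coe_coe]
      exact hsurj.comp e.surjective
    have h := OrzechProperty.injective_of_surjective_endomorphism _ hg
    simp only [LinearMap.coe_comp, LinearMap.coe_restrictScalars, LinearEquiv.coe_coe] at h
    exact (Function.Injective.of_comp_iff' _ e.bijective).1 h
  refine ⟨(Pi.basisFun PadicEisenstein ι).map (LinearEquiv.ofBijective φ ⟨hinj, hsurj⟩), fun i => ?_⟩
  rw [Module.Basis.map_apply, Pi.basisFun_apply, LinearEquiv.ofBijective_apply, hφ_single]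

end Free

end Literature.NumberTheory.GaloisRepresentations.PadicEisenstein

namespace Literature.NumberTheory.GaloisRepresentations

open Literature.NumberTheory.EllipticCurves SuperellipticFunctionField
open scoped Pointwise

universe u

section DeckThree

variable {K : Type u} [Field K] {f : K[X]}
  [Fact (Irreducible (superellipticPoly K (AlgebraicClosure K) 3 f))] {ζ : K}

/-- A primitive cube root of unity of `K` stays primitive in `K̄`. [folklore] -/
theorem isPrimitiveRoot_algebraMap_algebraicClosure (hζ : IsPrimitiveRoot ζ 3) :
    IsPrimitiveRoot (algebraMap K (AlgebraicClosure K) ζ) 3 :=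
  hζ.map_of_injective (algebraMap K (AlgebraicClosure K)).injective

/-- The deck transformation `δ : y ↦ ζ y` of `C_f : y³ = f(x)` over `K̄` attached to a primitive cube
root of unity `ζ ∈ K` (Zarhin's `δ₃`). [cite: Zarhin2018SuperellipticJacobians, §8] -/
def deckGen (hζ : IsPrimitiveRoot ζ 3) : CyclicCoverDeck (AlgebraicClosure K) 3 :=
  CyclicCoverDeck.ofRoot (isPrimitiveRoot_algebraMap_algebraicClosure hζ).pow_eq_one

variable (f) in
/-- `δ` as a `ℤ₃`-linear endomorphism of the Tate module `T₃ Pic(C_{f,K̄})` (coordinatewise).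
[cite: Zarhin2018SuperellipticJacobians, §8] -/
def deckEnd (hζ : IsPrimitiveRoot ζ 3) : Module.End ℤ_[3] (TateModule (GeomPic K 3 f) 3) :=
  DistribSMul.toLinearMap ℤ_[3] (TateModule (GeomPic K 3 f) 3) (deckGen hζ)

/-- `deckEnd hζ a = δ • a`. [folklore] -/
@[simp]
theorem deckEnd_apply (hζ : IsPrimitiveRoot ζ 3) (a : TateModule (GeomPic K 3 f) 3) :
    deckEnd f hζ a = deckGen hζ • a :=
  rfl

/-- The components of an element of the Tate module are torsion classes, hence of degree `0`. [folklore] -/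
theorem degree_proj_tateModule (n : ℕ) (a : TateModule (GeomPic K 3 f) 3) :
    SuperellipticPic.degree K (AlgebraicClosure K) 3 f (TateModule.proj 3 n a) = 0 :=
  jacobianTorsion_le_degreeZero K (AlgebraicClosure K) 3 f (pow_ne_zero n three_ne_zero)
    (TateModule.proj_mem_torsionBy n a)

/-- **`δ² + δ + 1 = 0` on `T₃ Pic(C_{f,K̄})`** (`3 ∤ deg f`): the norm relation
`1 + δ + δ² = 0` on degree-zero classes (`sum_deck_pow_smul_eq_zero_of_degree_eq_zero`), componentwise.
[cite: Zarhin2018SuperellipticJacobians, §8] [cite: Schaefer1998, §3] -/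
theorem deckEnd_sq_add_deckEnd_add_one (hζ : IsPrimitiveRoot ζ 3) (hsep : f.Separable)
    (hndvd : ¬ 3 ∣ f.natDegree) : deckEnd f hζ ^ 2 + deckEnd f hζ + 1 = 0 := by
  refine LinearMap.ext fun a => TateModule.ext fun n => ?_
  have h := sum_deck_pow_smul_eq_zero_of_degree_eq_zero (K := K) (isPrimitiveRoot_algebraMap_algebraicClosure hζ)
    hsep hndvd (degree_proj_tateModule n a)
  rw [Finset.sum_range_succ, Finset.sum_range_succ, Finset.sum_range_one, pow_zero, one_smul, pow_one,
    sq, mul_smul] at h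
  simp only [LinearMap.add_apply, Module.End.one_apply, sq, Module.End.mul_apply, deckEnd_apply,
    LinearMap.zero_apply, map_add, map_zero, TateModule.proj_smul_of_distribMulAction]
  rw [← h, deckGen]
  abel

variable (f) in
/-- **The `ℤ₃[ω]`-module structure on `T₃ Pic(C_{f,K̄})`**, `ω` acting as the deck transformation
`δ : y ↦ ζ y` (`PadicEisenstein.moduleOfEnd`; Zarhin §8: `ℤ[ζ₃] ↪ End J`, here `⊗ ℤ₃`).  A reducible
non-instance. [cite: Zarhin2018SuperellipticJacobians, §8] -/
abbrev tateModulePadicEisenstein (hζ : IsPrimitiveRoot ζ 3) (hsep : f.Separable) (hndvd : ¬ 3 ∣ f.natDegree) :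
    Module PadicEisenstein (TateModule (GeomPic K 3 f) 3) :=
  PadicEisenstein.moduleOfEnd (deckEnd f hζ) (deckEnd_sq_add_deckEnd_add_one hζ hsep hndvd)

/-- `ω • a = δ • a` on the Tate module. [folklore] -/
theorem omega_smul_tateModule (hζ : IsPrimitiveRoot ζ 3) (hsep : f.Separable) (hndvd : ¬ 3 ∣ f.natDegree)
    (a : TateModule (GeomPic K 3 f) 3) :
    letI := tateModulePadicEisenstein f hζ hsep hndvd
    PadicEisenstein.omega • a = deckGen hζ • a := by
  letI := tateModulePadicEisenstein f hζ hsep hndvd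
  rw [PadicEisenstein.moduleOfEnd_omega_smul, deckEnd_apply]

/-- `λ • a = a - δ • a` on the Tate module. [folklore] -/
theorem lam_smul_tateModule (hζ : IsPrimitiveRoot ζ 3) (hsep : f.Separable) (hndvd : ¬ 3 ∣ f.natDegree)
    (a : TateModule (GeomPic K 3 f) 3) :
    letI := tateModulePadicEisenstein f hζ hsep hndvd
    PadicEisenstein.lam • a = a - deckGen hζ • a := by
  letI := tateModulePadicEisenstein f hζ hsep hndvd
  rw [PadicEisenstein.lam, sub_smul, one_smul, omega_smul_tateModule]

/-- The `ℤ₃`- and `ℤ₃[ω]`-structures on the Tate module are compatible. [folklore] -/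
theorem isScalarTower_tateModule (hζ : IsPrimitiveRoot ζ 3) (hsep : f.Separable) (hndvd : ¬ 3 ∣ f.natDegree) :
    letI := tateModulePadicEisenstein f hζ hsep hndvd
    IsScalarTower ℤ_[3] PadicEisenstein (TateModule (GeomPic K 3 f) 3) :=
  PadicEisenstein.moduleOfEnd_isScalarTower _ _

/-- **`Γ_K` acts `ℤ₃[ω]`-linearly on `T₃ Pic(C_{f,K̄})`** (`ζ₃ ∈ K`: the deck group commutes with
`Γ_K`, `absoluteGaloisGroup_smul_deck_smul_tateModule`). [cite: Zarhin2018SuperellipticJacobians, §8] -/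
theorem absoluteGaloisGroup_smul_padicEisenstein_smul (hζ : IsPrimitiveRoot ζ 3) (hsep : f.Separable)
    (hndvd : ¬ 3 ∣ f.natDegree) (σ : Field.absoluteGaloisGroup K) (z : PadicEisenstein)
    (a : TateModule (GeomPic K 3 f) 3) :
    letI := tateModulePadicEisenstein f hζ hsep hndvd
    σ • (z • a) = z • (σ • a) := by
  letI := tateModulePadicEisenstein f hζ hsep hndvd
  have h := PadicEisenstein.moduleOfEnd_map_smul (deckEnd f hζ) (deckEnd_sq_add_deckEnd_add_one hζ hsep hndvd)
    (DistribSMul.toLinearMap ℤ_[3] (TateModule (GeomPic K 3 f) 3) σ) (LinearMap.ext fun b => ?_) z a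
  · exact h
  · simp only [Module.End.mul_apply, DistribSMul.toLinearMap_apply, deckEnd_apply]
    exact absoluteGaloisGroup_smul_deck_smul_tateModule K 3 f ⟨ζ, hζ⟩ 3 σ (deckGen hζ) b

/-! ### `#(T/λT) = #J[λ]` -/

/-- `x ↦ x - δ x` on `Pic(C_{f,K̄})` (the action of `λ = 1 - ω`). [folklore] -/
def lamAddMonoidHom (hζ : IsPrimitiveRoot ζ 3) : GeomPic K 3 f →+ GeomPic K 3 f :=
  AddMonoidHom.id _ - DistribSMul.toAddMonoidHom (GeomPic K 3 f) (deckGen hζ)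

/-- Unfolding lemma for `lamAddMonoidHom`. [folklore] -/
@[simp]
theorem lamAddMonoidHom_apply (hζ : IsPrimitiveRoot ζ 3) (x : GeomPic K 3 f) :
    lamAddMonoidHom hζ x = x - deckGen hζ • x :=
  rfl

/-- `proj_n (λ • a) = (1 - δ)(proj_n a)`. [folklore] -/
theorem proj_lam_smul (hζ : IsPrimitiveRoot ζ 3) (hsep : f.Separable) (hndvd : ¬ 3 ∣ f.natDegree)
    (a : TateModule (GeomPic K 3 f) 3) (n : ℕ) :
    letI := tateModulePadicEisenstein f hζ hsep hndvd
    TateModule.proj 3 n (PadicEisenstein.lam • a) = lamAddMonoidHom hζ (TateModule.proj 3 n a) := by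
  letI := tateModulePadicEisenstein f hζ hsep hndvd
  rw [lam_smul_tateModule, map_sub, TateModule.proj_smul_of_distribMulAction, lamAddMonoidHom_apply]

/-- A class fixed by `δ` is fixed by the whole deck group `μ₃(K̄) = ⟨δ⟩`. [folklore] -/
theorem forall_deck_smul_eq_of_deckGen_smul_eq (hζ : IsPrimitiveRoot ζ 3) {c : GeomPic K 3 f}
    (hc : deckGen hζ • c = c) : ∀ ξ : CyclicCoverDeck (AlgebraicClosure K) 3, ξ • c = c := by
  intro ξ
  obtain ⟨j, -, rfl⟩ := CyclicCoverDeck.exists_eq_ofRoot_pow (isPrimitiveRoot_algebraMap_algebraicClosure hζ) ξ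
  change deckGen hζ ^ j • c = c
  induction j with
  | zero => rw [pow_zero, one_smul]
  | succ j ih => rw [pow_succ, mul_smul, hc, ih]

/-- **`ker (1 - δ) ∩ Pic[3] = J[λ]`** on `Pic(C_{f,K̄})` (`3 ∤ deg f`): torsion classes have degree `0`,
a `δ`-fixed class is deck-fixed, and `J[λ] ⊆ J[3]`. [cite: Zarhin2018SuperellipticJacobians, §8] -/
theorem mem_geomLambdaTorsion_iff (hζ : IsPrimitiveRoot ζ 3) (hsep : f.Separable) (hndvd : ¬ 3 ∣ f.natDegree)
    (c : GeomPic K 3 f) :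
    c ∈ geomLambdaTorsion K 3 f ↔ c ∈ AddSubgroup.torsionBy (GeomPic K 3 f) (3 : ℕ) ∧ lamAddMonoidHom hζ c = 0 := by
  constructor
  · intro hc
    refine ⟨?_, ?_⟩
    · exact AddSubgroup.torsionBy.nsmul_iff.2
        (nsmul_eq_zero_of_mem_lambdaTorsion (isPrimitiveRoot_algebraMap_algebraicClosure hζ) hsep hndvd hc)
    · rw [lamAddMonoidHom_apply, ((mem_lambdaTorsion _ _ _ _).1 hc).2, sub_self]
  · rintro ⟨h3, hl⟩
    rw [lamAddMonoidHom_apply, sub_eq_zero] at hl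
    exact (mem_lambdaTorsion _ _ _ _).2 ⟨jacobianTorsion_le_degreeZero K (AlgebraicClosure K) 3 f three_ne_zero h3,
      forall_deck_smul_eq_of_deckGen_smul_eq hζ hl.symm⟩

/-- **`#(T/λT) = #J[λ]` for `T = T₃ Pic(C_{f,K̄})`** (`ζ₃ ∈ K`, `3 ∤ deg f`, `#Pic[3ⁿ] = 3^{dn}`):
`T → Pic[3] → Pic[3]/(1-δ)Pic[3]` is onto (the projections `T → Pic[3ⁿ]` are onto) with kernel
`λT + 3T = λT` (`3 = -ω²λ²`), and `(1 - δ) : Pic[3] → Pic[3]` has kernel `Pic[3] ∩ ker(1-δ) = J[λ]`.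
This is the count feeding `PadicEisenstein.nonempty_basis_of_card_quotient`.
[cite: SerreAbelianLadic1968, Ch. I §1.1] [cite: Zarhin2018SuperellipticJacobians, §8] -/
theorem card_quotient_lamSubmodule (hζ : IsPrimitiveRoot ζ 3) (hsep : f.Separable) (hndvd : ¬ 3 ∣ f.natDegree)
    {d : ℕ} (hcard : ∀ n, Nat.card (AddSubgroup.torsionBy (GeomPic K 3 f) (3 ^ n : ℕ)) = 3 ^ (d * n)) :
    letI := tateModulePadicEisenstein f hζ hsep hndvd
    Nat.card (TateModule (GeomPic K 3 f) 3 ⧸ PadicEisenstein.lamSubmodule (TateModule (GeomPic K 3 f) 3)) =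
      Nat.card (geomLambdaTorsion K 3 f) := by
  classical
  letI := tateModulePadicEisenstein f hζ hsep hndvd
  haveI := isScalarTower_tateModule hζ hsep hndvd
  set A₃ : AddSubgroup (GeomPic K 3 f) := AddSubgroup.torsionBy (GeomPic K 3 f) (3 : ℕ) with hA₃
  set Λ₀ : AddSubgroup (GeomPic K 3 f) := A₃.map (lamAddMonoidHom hζ) with hΛ₀
  have hmemA₃ : ∀ a : TateModule (GeomPic K 3 f) 3, TateModule.proj 3 1 a ∈ A₃ := fun a => by
    simpa [hA₃, pow_one] using TateModule.proj_mem_torsionBy 1 a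
  have hliftA₃ : ∀ x ∈ A₃, ∃ b : TateModule (GeomPic K 3 f) 3, TateModule.proj 3 1 b = x := fun x hx => by
    have hx1 : x ∈ AddSubgroup.torsionBy (GeomPic K 3 f) (3 ^ 1 : ℕ) := by rwa [pow_one]
    exact TateModule.proj_surjective_of_card hcard 1 hx1
  -- (a) `Λ₀ ≤ A₃`
  have hΛA : Λ₀ ≤ A₃ := by
    rintro _ ⟨x, hx, rfl⟩
    have hx' : (3 : ℕ) • x = 0 := AddSubgroup.torsionBy.nsmul_iff.1 hx
    refine AddSubgroup.torsionBy.nsmul_iff.2 ?_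
    rw [lamAddMonoidHom_apply, smul_sub, smul_comm, hx', smul_zero, sub_zero]
  -- (b) the map `T → Pic / Λ₀` and its kernel `λT`
  set Φ : TateModule (GeomPic K 3 f) 3 →+ GeomPic K 3 f ⧸ Λ₀ :=
    (QuotientAddGroup.mk' Λ₀).comp (TateModule.proj 3 1) with hΦ
  have hker : Φ.ker = (PadicEisenstein.lamSubmodule (TateModule (GeomPic K 3 f) 3)).toAddSubgroup := by
    ext a
    rw [AddMonoidHom.mem_ker, Submodule.mem_toAddSubgroup, PadicEisenstein.mem_lamSubmodule_iff, hΦ,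
      AddMonoidHom.comp_apply, QuotientAddGroup.mk'_apply, QuotientAddGroup.eq_zero_iff]
    constructor
    · rintro ⟨x, hx, hxa⟩
      obtain ⟨b, hb⟩ := hliftA₃ x hx
      have h0 : TateModule.proj 3 1 (a - PadicEisenstein.lam • b) = 0 := by
        rw [map_sub, proj_lam_smul, hb, hxa, sub_self]
      refine ⟨b + PadicEisenstein.lam • (-(PadicEisenstein.omega ^ 2) •
        TateModule.div (a - PadicEisenstein.lam • b) h0), ?_⟩
      rw [smul_add, ← PadicEisenstein.three_smul_eq, show (3 : ℤ_[3]) = ((3 : ℕ) : ℤ_[3]) by norm_num,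
        TateModule.p_smul_div, add_sub_cancel]
    · rintro ⟨s, rfl⟩
      exact ⟨TateModule.proj 3 1 s, hmemA₃ s, (proj_lam_smul hζ hsep hndvd s 1).symm⟩
  -- (c) `#(T/λT) = #(image of Pic[3] in Pic/Λ₀)`
  have hrange : Φ.range = A₃.map (QuotientAddGroup.mk' Λ₀) := by
    apply le_antisymm
    · rintro _ ⟨a, rfl⟩
      exact ⟨TateModule.proj 3 1 a, hmemA₃ a, rfl⟩
    · rintro _ ⟨x, hx, rfl⟩
      obtain ⟨b, hb⟩ := hliftA₃ x hx
      exact ⟨b, by rw [hΦ, AddMonoidHom.comp_apply, hb]⟩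
  have hcardQ : Nat.card (TateModule (GeomPic K 3 f) 3 ⧸ PadicEisenstein.lamSubmodule (TateModule (GeomPic K 3 f) 3)) =
      Nat.card (A₃.map (QuotientAddGroup.mk' Λ₀)) := by
    rw [← hrange, ← AddSubgroup.index_ker, hker]
    rfl
  -- (d) `#Λ₀ · #(Pic[3]/Λ₀) = #Pic[3]`
  have h1 : Nat.card Λ₀ * Nat.card (A₃.map (QuotientAddGroup.mk' Λ₀)) = Nat.card A₃ := by
    rw [← AddSubgroup.relIndex_ker (K := A₃) (f := QuotientAddGroup.mk' Λ₀), QuotientAddGroup.ker_mk', AddSubgroup.relIndex,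
      ← Nat.card_congr (AddSubgroup.addSubgroupOfEquivOfLe hΛA).toEquiv, AddSubgroup.card_mul_index]
  -- (e) `#J[λ] · #Λ₀ = #Pic[3]`
  have hle : geomLambdaTorsion K 3 f ≤ A₃ := fun x hx => ((mem_geomLambdaTorsion_iff hζ hsep hndvd x).1 hx).1
  have h2 : Nat.card (geomLambdaTorsion K 3 f) * Nat.card Λ₀ = Nat.card A₃ := by
    have hr : ((lamAddMonoidHom hζ).comp A₃.subtype).range = Λ₀ := by
      rw [← AddMonoidHom.map_range, AddSubgroup.range_subtype]
    have hk : ((lamAddMonoidHom hζ).comp A₃.subtype).ker = (geomLambdaTorsion K 3 f).addSubgroupOf A₃ := by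
      ext ⟨x, hx⟩
      rw [AddMonoidHom.mem_ker, AddSubgroup.mem_addSubgroupOf, AddMonoidHom.comp_apply, AddSubgroup.coe_subtype,
        mem_geomLambdaTorsion_iff hζ hsep hndvd]
      exact ⟨fun h => ⟨hx, h⟩, fun h => h.2⟩
    rw [← hr, ← AddSubgroup.index_ker, hk, ← Nat.card_congr (AddSubgroup.addSubgroupOfEquivOfLe hle).toEquiv,
      AddSubgroup.card_mul_index]
  -- (f) conclude
  have hA₃0 : Nat.card A₃ ≠ 0 := by
    have h := hcard 1
    rw [pow_one, mul_one] at h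
    change Nat.card A₃ = 3 ^ d at h
    rw [h]
    positivity
  haveI : Finite A₃ := Nat.finite_of_card_ne_zero hA₃0
  haveI : Finite Λ₀ := Finite.of_equiv _ (AddSubgroup.addSubgroupOfEquivOfLe hΛA).toEquiv
  have hΛ0 : 0 < Nat.card Λ₀ := Nat.card_pos
  rw [hcardQ]
  have h := h1.trans h2.symm
  rw [mul_comm (Nat.card (geomLambdaTorsion K 3 f))] at h
  exact Nat.eq_of_mul_eq_mul_left hΛ0 h

/-- **`T₃ Pic(C_{f,K̄})` is free of rank `r` over `ℤ₃[ω]`** when `#Pic[3ⁿ] = 3^{2rn}` and `#J[λ] = 3^r`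
(`PadicEisenstein.nonempty_basis_of_card_quotient` with `card_quotient_lamSubmodule`).
[cite: SerreAbelianLadic1968, Ch. I §1.1] [cite: Zarhin2018SuperellipticJacobians, §8] -/
theorem nonempty_basis_tateModule (hζ : IsPrimitiveRoot ζ 3) (hsep : f.Separable) (hndvd : ¬ 3 ∣ f.natDegree)
    {r : ℕ} (hcard : ∀ n, Nat.card (AddSubgroup.torsionBy (GeomPic K 3 f) (3 ^ n : ℕ)) = 3 ^ (2 * r * n))
    (hlam : Nat.card (geomLambdaTorsion K 3 f) = 3 ^ r) :
    letI := tateModulePadicEisenstein f hζ hsep hndvd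
    Nonempty (Module.Basis (Fin r) PadicEisenstein (TateModule (GeomPic K 3 f) 3)) := by
  letI := tateModulePadicEisenstein f hζ hsep hndvd
  haveI := isScalarTower_tateModule hζ hsep hndvd
  haveI := TateModule.free_of_card_torsionBy_rank hcard
  haveI := TateModule.finite_of_card_torsionBy_rank hcard
  exact PadicEisenstein.nonempty_basis_of_card_quotient (TateModule.finrank_eq_of_card_torsionBy hcard)
    (by rw [card_quotient_lamSubmodule hζ hsep hndvd hcard, hlam])

/-- Under `#Pic[3ⁿ] = 3^{2rn}` the Tate module is free of rank `2r` over `ℤ₃`. [folklore] -/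
theorem free_tateModule {r : ℕ} (hcard : ∀ n, Nat.card (AddSubgroup.torsionBy (GeomPic K 3 f) (3 ^ n : ℕ)) = 3 ^ (2 * r * n)) :
    Module.Free ℤ_[3] (TateModule (GeomPic K 3 f) 3) :=
  TateModule.free_of_card_torsionBy_rank hcard

end DeckThree

/-! ### The Picard curve: `#J[λ] = 27` and `T₃ J ≅ ℤ₃[ω]³` -/

section Picard

variable (K : Type u) [Field K] [CharZero K] [IsCyclotomicExtension {3} ℚ K]

/-- **`#J_f[1 - ω] = 27`** for the Picard curve `y³ = f(x)`, `f` a separable quartic: `J_f[1 - ω]` is the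
heart `(𝔽₃^{roots f})⁰` (`picard_lambdaTorsion_iso_heart`), of `𝔽₃`-dimension `4 - 1`.
[cite: Schaefer1998, §3 Prop. 3.2] [cite: Zarhin2018SuperellipticJacobians, §8 (i) (arXiv p. 22)] -/
theorem picard_card_geomLambdaTorsion (f : ℤ[X]) (h4 : f.natDegree = 4) (hsep : (f.map (Int.castRingHom ℚ)).Separable) :
    haveI := fact_irreducible_superellipticPoly_picard K h4 hsep
    Nat.card (geomLambdaTorsion K 3 (f.map (algebraMap ℤ K))) = 3 ^ 3 := by
  haveI := fact_irreducible_superellipticPoly_picard K h4 hsep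
  haveI : Nonempty ((f.map (algebraMap ℤ K)).rootSet (AlgebraicClosure K)) :=
    Fintype.card_pos_iff.1 (by rw [card_rootSet_map_algebraMap_int K h4 hsep]; norm_num)
  obtain ⟨Ψ, hinj, hrange, -⟩ := picard_lambdaTorsion_iso_heart K f h4 hsep
  rw [← hrange, ← Nat.card_congr (AddMonoidHom.ofInjective hinj).toEquiv,
    ← Nat.card_congr (augmentationEquivHeart 3 _ (not_three_dvd_card_rootSet K h4 hsep)).toEquiv,
    Module.natCard_eq_pow_finrank (K := ZMod 3), Nat.card_zmod, finrank_augmentationSubmodule,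
    Nat.card_eq_fintype_card, card_rootSet_map_algebraMap_int K h4 hsep]

omit [IsCyclotomicExtension {3} ℚ K] in
/-- `3 ∤ deg f_K = 4`. [folklore] -/
theorem not_three_dvd_natDegree_map {f : ℤ[X]} (h4 : f.natDegree = 4) : ¬ 3 ∣ (f.map (algebraMap ℤ K)).natDegree := by
  rw [natDegree_map_algebraMap_int_eq K h4]; decide

/-- **`T₃ J(C_f) ≅ ℤ₃[ω]³` for the Picard curve** (given the torsion count `#J_f[3ⁿ] = 3^{6n}` of a
genus-`3` curve): the `ℤ₃[ω]`-module `T₃ J(C_f)` (`ω ↦ (y ↦ ζ y)`) is free of rank `3`.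
[cite: Upton2009, §2] [cite: SerreAbelianLadic1968, Ch. I §1.1] -/
theorem picard_nonempty_basis_tateModule (f : ℤ[X]) (h4 : f.natDegree = 4)
    (hsep : (f.map (Int.castRingHom ℚ)).Separable) {ζ : K} (hζ : IsPrimitiveRoot ζ 3)
    (hcard : haveI := fact_irreducible_superellipticPoly_picard K h4 hsep
      ∀ n, Nat.card (AddSubgroup.torsionBy (GeomPic K 3 (f.map (algebraMap ℤ K))) (3 ^ n : ℕ)) = 3 ^ (2 * 3 * n)) :
    haveI := fact_irreducible_superellipticPoly_picard K h4 hsep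
    letI := tateModulePadicEisenstein (f.map (algebraMap ℤ K)) hζ (separable_map_algebraMap_int K hsep)
      (not_three_dvd_natDegree_map K h4)
    Nonempty (Module.Basis (Fin 3) PadicEisenstein (TateModule (GeomPic K 3 (f.map (algebraMap ℤ K))) 3)) := by
  haveI := fact_irreducible_superellipticPoly_picard K h4 hsep
  exact nonempty_basis_tateModule hζ (separable_map_algebraMap_int K hsep) (not_three_dvd_natDegree_map K h4) hcard
    (picard_card_geomLambdaTorsion K f h4 hsep)

end Picard

end Literature.NumberTheory.GaloisRepresentations
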